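import Literature.Computability.MetaComplexity.ResolutionTseitinProofs
import Summits.PneNP.PneNP.Theorems.ReslinMediumCoverManyMediumLinesEdgeFlip

/-!
# PneNP / ReslinMediumCover — every vertex has a critical assignment of `τ(G, c) ∘ MAJ₃`
(connected `G`, odd charge) (helper for crux `ManyMediumLines`, stmt-PneNP-19698)

Route `PneNP/ReslinMediumCover`, crux `Summit.PneNP.PneNP.Theses.ReslinMediumCover.ManyMediumLines`
(open problem; NOT claimed). The proved rung `exists_medium_critSupport_of_isResLinRefutation` and
the rank corollary of the boundary law (`ResLinBoundaryLaw.lt_resLinWidth_of_isResLinRefutation`)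
carry the hypothesis "every vertex `u` has a `u`-critical assignment" (`(critAt G c u).Nonempty`).
This file discharges it from the route's hypotheses: if `G` is connected and the number of charged
vertices is odd, then for every `u` the charge `c + 1_u` is even, hence (Urquhart 1987, Lemma 4.1,
"conversely": `exists_edgeLabel_of_sum_eq_zero`) realised by an edge labelling `y`; the assignment
giving all three copies of every edge variable the value `y_e` has lifted edge values `y`
(`MAJ₃(b, b, b) = b`) and is therefore `u`-critical (`critAt_nonempty_of_connected`).

References: A. Urquhart, *Hard examples for resolution*, J. ACM 34 (1987), §4, Lemma 4.1
(realising even charges on connected graphs); S. Jukna, *Boolean Function Complexity* (2012),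
§18.7 (critical assignments of Tseitin formulas).
-/

namespace Summit.PneNP.PneNP.Theorems

-- `Summit.PneNP.PneNP` repeats a path component by design (summit = sub-problem); silence the linter.
set_option linter.dupNamespace false

namespace ResLinBoundaryLaw

open Finset Literature.Computability.Complexity Literature.Computability.MetaComplexity

variable {N : ℕ} (G : SimpleGraph (Fin N)) [DecidableRel G.Adj] (c : Fin N → Bool)

/-- **Lifting an edge labelling**: for every edge labelling `y` there is an assignment of the `3N²`
slots whose lifted edge values are `y` (all three copies of `x_e` set to `y e`). [Bhattacharya–
Byramji–Chattopadhyay–Impagliazzo 2026, §1 (the lifted formula; `MAJ₃(b,b,b) = b`)] -/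
theorem exists_edgeVal_eq (y : Sym2 (Fin N) → Bool) :
    ∃ x : Fin (3 * N ^ 2) → Bool, ∀ e : Sym2 (Fin N), edgeVal (pad x) e = y e := by
  classical
  -- slot `s` ↦ the value of the (unique) edge it belongs to
  let x : Fin (3 * N ^ 2) → Bool := fun s =>
    if h : ∃ e : Sym2 (Fin N), ∃ i : Fin 3, (s : ℕ) = liftVar e i.1 then y h.choose else false
  refine ⟨x, fun e => ?_⟩
  have hslot : ∀ (i : ℕ) (hi : i < 3), pad x (liftVar e i) = y e := by
    intro i hi
    rw [pad_liftVar x e hi]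
    have hex : ∃ e' : Sym2 (Fin N), ∃ i' : Fin 3,
        ((⟨liftVar e i, liftVar_lt e hi⟩ : Fin (3 * N ^ 2)) : ℕ) = liftVar e' i'.1 :=
      ⟨e, ⟨i, hi⟩, rfl⟩
    show (if h : ∃ e' : Sym2 (Fin N), ∃ i' : Fin 3,
        ((⟨liftVar e i, liftVar_lt e hi⟩ : Fin (3 * N ^ 2)) : ℕ) = liftVar e' i'.1
        then y h.choose else false) = y e
    rw [dif_pos hex]
    obtain ⟨i', hi'⟩ := hex.choose_spec
    have := (liftVar_inj hi i'.2 hi').1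
    rw [← this]
  unfold edgeVal
  rw [hslot 0 (by norm_num), hslot 1 (by norm_num), hslot 2 (by norm_num)]
  cases y e <;> rfl

/-- **Every vertex has a critical assignment** (connected graph, odd charge): for every `u` some
assignment of the `3N²` slots violates the lifted parity constraint of `u` and satisfies all the
others. (The charge `c + 1_u` is even, so it is realised by an edge labelling — Urquhart 1987,
Lemma 4.1 — which is then lifted copy-wise.) [Urquhart 1987, Lemma 4.1; Jukna 2012, §18.7] -/
theorem critAt_nonempty_of_connected (hG : G.Connected)
    (hodd : Odd (Finset.univ.filter fun u => c u = true).card) (u : Fin N) :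
    (critAt G c u).Nonempty := by
  classical
  -- the target charge `c + 1_u`, which is even
  let c' : Fin N → ZMod 2 := fun w => (if c w = true then 1 else 0) + (if w = u then 1 else 0)
  have hsum : ∑ w, c' w = 0 := by
    simp only [c', Finset.sum_add_distrib]
    rw [Finset.sum_ite_eq', Finset.sum_boole, if_pos (Finset.mem_univ u),
      (ZMod.natCast_eq_one_iff_odd).mpr hodd]
    decide
  obtain ⟨yz, hyz⟩ := exists_edgeLabel_of_sum_eq_zero G hG _ c' le_rfl hsum
  -- the edge labelling as Booleans, lifted copy-wise
  obtain ⟨x, hx⟩ := exists_edgeVal_eq (N := N) (fun e => decide (yz e = 1))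
  refine ⟨x, ?_⟩
  rw [mem_critAt]
  intro w
  -- the parity count at `w` is `c' w`
  have hcount : ((((G.neighborFinset w).filter fun w' => edgeVal (pad x) s(w, w') = true).card
      : ℕ) : ZMod 2) = c' w := by
    rw [← hyz w]
    have hfilter : ((G.neighborFinset w).filter fun w' => edgeVal (pad x) s(w, w') = true) =
        (Finset.univ.filter (G.Adj w ·)).filter fun w' => yz s(w, w') = 1 := by
      ext w'
      simp only [Finset.mem_filter, SimpleGraph.mem_neighborFinset, Finset.mem_univ, true_and, hx,
        decide_eq_true_eq]
    rw [hfilter, Finset.natCast_card_filter]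
    refine Finset.sum_congr rfl (fun w' _ => ?_)
    have h2 : ∀ a : ZMod 2, (if a = 1 then (1 : ZMod 2) else 0) = a := by decide
    exact h2 _
  unfold vertexOK
  rw [decide_eq_true_eq, mod_two_eq_toNat_iff, hcount]
  have h01 : ∀ a : ZMod 2, a + 1 ≠ a := by decide
  by_cases hwu : w = u
  · subst hwu
    simp only [c', if_true]
    constructor
    · intro h
      exact absurd h (h01 _)
    · intro h
      exact absurd rfl h
  · simp only [c', if_neg hwu, add_zero]
    exact ⟨fun _ => hwu, fun _ => trivial⟩

end ResLinBoundaryLaw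

end Summit.PneNP.PneNP.Theorems
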